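import Summits.BirchSwinnertonDyer.Rank2.LevelFifteenEisensteinPeriod
import HarnessLib

/-!
# Manin symbols on `Γ₀(15)`, X: the EISENSTEIN PERIOD LAW — `(15/4)·φ ≡ n₁ + ψ (mod 4)`: the period homomorphism of the
# `(3,1)`-stabilised weight-2 Eisenstein series of level 15 is congruent, at the scale `4/15` and modulo `4`, to the
# `E₁`-coordinate of the exact Manin descent plus a LEVEL-15 CONGRUENCE CHARACTER

Cell `bsd-rank2` (D-0036), seat `bsd-rank2-eng` GEN 10; line `star` of the crux E1M `DepletedLambdaLawAtTwoMod`
(item stmt-BirchSwinnertonDyer-20341): the level-15 engineering rung for the research stub (★-SymbC). With part IX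
(`LevelFifteenEisensteinPeriod`: `eisPeriod15 = Ψ₃ + (1/5)Ψ₅ − (1/5)Ψ₁₅`, its extension `eisE` to `SL(2, ℤ)` and the two
moves `eisE_mul_T`, `eisE_mul_S` with the kernel-evaluated Schreier tables `eT4`, `eS4`):

* `lawTab : Fin 15 → Fin 15 → ℤ` — the table `G(c mod 15, d mod 15)`; **`eisE_law`**: for every `k = (a b; c d) ∈ SL(2, ℤ)`
  and fuel `n > |c|`, `(15/4)·eisE k − (descentF n c d).1 − G(c̄, d̄) ∈ 4ℤ` — induction along the exact Euclid descent of
  part III (`LevelFifteenExactDescent`) with the finite steps `law_step` / `law_period` (kernel-decided over `(ℤ/15)²`) and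
  the `T^{15j}`-surplus lemma `eisE_mul_T_zpow_fifteen`;
* **`eisPeriod15_law_gamma0`**: on `Γ₀(15)`, `(15/4)·φ(γ) − n₁(γ) − ψ(d) ∈ 4ℤ` where `ψ = lawTab 0` is the class of `d` in
  `(ℤ/15)ˣ/±1 ≅ ℤ/4` (`±1, ±2, ±4, ±8 ↦ 0, 1, 2, 3`), the character of the cyclic cover `X₁(15) → X₀(15)`. NEITHER `n₁ mod 4`
  NOR `(15/4)φ mod 4` is a congruence function of the matrix (seat numerics: `n₁ mod 4` is not periodic modulo `240` in the
  bottom row), but their DIFFERENCE is, of level `15` — the mod-4 shadow of the Eisenstein congruence `15A ≡ E_{(3,1)}`;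
* **`law_pair`**: for two matrices with the same lower-left entry and `15 ∣ d, 15 ∣ d'` (the matrices `(a, −x; 2^m, 15y)` of
  the dyadic cusps `a/2^m`), `(15/4)·(φ(kS⁻¹) − φ(k'S⁻¹)) − (n₁(k) − n₁(k')) ∈ 4ℤ` — the character cancels. This is the
  Eisenstein input of the level-15 (★-SymbC) theorem (`Theorems/EisensteinDepletionAtTwoStarSymbCRefFifteen.lean`).

THEOREMS + one integer table (`lawTab`, data re-verified by `decide`); no `sorry`; standard axioms. PARTITION: none —
r_an ≥ 2, summit axis S0; TWIN (D-0056): n/a. B1 honesty: finite Dedekind-sum / Manin-symbol arithmetic at level 15; nothing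
reads an analytic rank; no S0 motion; (★-SymbC) for general `N` is NOT proved by this.

References: H. Rademacher, E. Grosswald, *Dedekind Sums*, Carus Monograph 16 (1972), Ch. 4 A eq. (59)–(62)
[RademacherGrosswald1972]; G. Stevens, *Arithmetic on Modular Curves*, Progr. Math. 20 (1982), §2.4–2.5 [Stevens1982];
Ju. I. Manin, *Izv. AN SSSR* 36 (1972) Thm. 1.6 [Manin1972]; J. E. Cremona, *Algorithms for modular elliptic curves* (1997)
§2.2–§2.3 [CremonaAlgorithms1997].
-/

namespace Summit.BirchSwinnertonDyer.Rank2.LevelFifteen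

open scoped MatrixGroups ModularForm
open CongruenceSubgroup Matrix.SpecialLinearGroup ModularGroup
open Literature.NumberTheory.ModularForms

/-! ### §1 The law table and the finite steps -/

/-- The law table `G(c mod 15, d mod 15) = (15/4)·eisE(k) − n₁(k) mod 4` (rows `c`, columns `d`; `0` on inadmissible cells).
On the row `c ≡ 0` (i.e. on `Γ₀(15)`) it is the class of `d` in `(ℤ/15)ˣ/±1 ≅ ℤ/4` (`1, 2, 4, 8 ↦ 0, 1, 2, 3`). [folklore] -/
def lawTab : Fin 15 → Fin 15 → ℤ :=
  ![![0, 0, 1, 0, 2, 0, 0, 3, 3, 0, 0, 2, 0, 1, 0],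
    ![0, 0, 0, 0, 0, 0, 0, 0, 0, 0, 0, 0, 0, 0, 0],
    ![1, 1, 1, 1, 1, 1, 1, 1, 1, 1, 1, 1, 1, 1, 1],
    ![0, 0, 1, 0, 2, 0, 0, 3, 3, 0, 2, 2, 0, 1, 0],
    ![2, 2, 2, 2, 2, 2, 2, 2, 2, 2, 2, 2, 2, 2, 2],
    ![0, 0, 1, 0, 2, 0, 3, 3, 3, 1, 0, 2, 2, 1, 0],
    ![0, 0, 1, 0, 2, 3, 0, 3, 3, 0, 1, 2, 0, 1, 0],
    ![3, 3, 3, 3, 3, 3, 3, 3, 3, 3, 3, 3, 3, 3, 3],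
    ![3, 3, 3, 3, 3, 3, 3, 3, 3, 3, 3, 3, 3, 3, 3],
    ![0, 0, 1, 0, 2, 1, 0, 3, 3, 0, 3, 2, 0, 1, 0],
    ![0, 0, 1, 2, 2, 0, 1, 3, 3, 3, 0, 2, 0, 1, 0],
    ![2, 2, 2, 2, 2, 2, 2, 2, 2, 2, 2, 2, 2, 2, 2],
    ![0, 0, 1, 0, 2, 2, 0, 3, 3, 0, 0, 2, 0, 1, 0],
    ![1, 1, 1, 1, 1, 1, 1, 1, 1, 1, 1, 1, 1, 1, 1],
    ![0, 0, 0, 0, 0, 0, 0, 0, 0, 0, 0, 0, 0, 0, 0]]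

/-- `Σ_{i<j} eT4(cls(x, y + i·x))` on residues (`15/4 ·` the Eisenstein correction of `j` successive `T`-moves). [folklore] -/
def tCorrE (x y : ZMod 15) : ℕ → ℤ
  | 0 => 0
  | j + 1 => tCorrE x y j + eT4 (clsTab x (y + j * x))

/-- **The inductive step, a finite check**: for admissible `(x, y)` and `j < 15`,
`G(y, −x) − eS4(cls(x,y)) + sA1(cls(x,y)) + Σ_{i<j} eT4 − Σ_{i<j} tA1 ≡ G(x, jx + y) (mod 4)`. [folklore] -/
theorem law_step : ∀ (x y : ZMod 15) (j : Fin 15), admZ x y = true →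
    (4 : ℤ) ∣ lawTab y (-x) - eS4 (clsTab x y) + sA1 (clsTab x y) + tCorrE x y j.val - tCorrZ x y j.val -
      lawTab x ((j.val : ℤ) * x + y) := by
  decide +kernel

/-- **Fifteen successive `T`-moves change `(15/4)·eisE` by a multiple of `4`** (the parabolic periods
`φ(rep_P T¹⁵ rep_P⁻¹) ∈ (16/15)ℤ`): `4 ∣ Σ_{i<15} eT4(cls(x, y + ix))`. [folklore] -/
theorem law_period : ∀ (x y : ZMod 15), admZ x y = true → (4 : ℤ) ∣ tCorrE x y 15 := by
  decide +kernel

/-- The base cells: `G(0, ±1) = 0`. [folklore] -/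
theorem lawTab_base : lawTab ((0 : ℤ) : ZMod 15) ((1 : ℤ) : ZMod 15) = 0 ∧
    lawTab ((0 : ℤ) : ZMod 15) ((-1 : ℤ) : ZMod 15) = 0 := by
  constructor <;> decide

/-! ### §2 Iterated `T`-moves of `eisE` -/

/-- **`Tʲ`-move** (`j ≥ 0`): `eisE(kTʲ) = eisE(k) + (4/15)·Σ_{i<j} eT4(cls(c, d + ic))`. [cite: Manin1972, Thm. 1.6] -/
theorem eisE_mul_T_pow (k : SL(2, ℤ)) (j : ℕ) :
    eisE (k * T ^ j) = eisE k + (tCorrE ((k 1 0 : ℤ) : ZMod 15) ((k 1 1 : ℤ) : ZMod 15) j : ℚ) * 4 / 15 := by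
  induction j with
  | zero => simp [tCorrE]
  | succ j ih =>
    rw [pow_succ, ← mul_assoc, eisE_mul_T, ih, (mul_T_pow_apply k j).1, (mul_T_pow_apply k j).2, clsInt]
    simp only [tCorrE]
    push_cast
    ring

/-- **`T^{15j}`-moves** (`j ∈ ℤ`) change `(15/4)·eisE` by a multiple of `4`. [cite: Manin1972, Thm. 1.6] -/
theorem eisE_mul_T_zpow_fifteen (k : SL(2, ℤ)) (j : ℤ) :
    ∃ z : ℤ, (15 / 4 : ℚ) * (eisE (k * T ^ (15 * j)) - eisE k) = 4 * z := by
  induction j using Int.induction_on generalizing k with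
  | zero => exact ⟨0, by simp⟩
  | succ i ih =>
    obtain ⟨z, hz⟩ := ih k
    obtain ⟨w, hw⟩ := law_period (((k * T ^ (15 * (i : ℤ))) 1 0 : ℤ) : ZMod 15)
      (((k * T ^ (15 * (i : ℤ))) 1 1 : ℤ) : ZMod 15) (admZ_of_isCoprime (isCoprime_row _ 1))
    have h15 := eisE_mul_T_pow (k * T ^ (15 * (i : ℤ))) 15
    refine ⟨z + w, ?_⟩
    have e : k * T ^ (15 * ((i : ℤ) + 1)) = k * T ^ (15 * (i : ℤ)) * T ^ (15 : ℕ) := by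
      rw [mul_assoc, ← zpow_natCast, ← zpow_add]; congr 2
    rw [e, h15, hw]
    push_cast
    linear_combination hz
  | pred i ih =>
    obtain ⟨z, hz⟩ := ih k
    set k' : SL(2, ℤ) := k * T ^ (15 * (-(i : ℤ) - 1)) with hk'
    obtain ⟨w, hw⟩ := law_period (((k' 1 0 : ℤ)) : ZMod 15) (((k' 1 1 : ℤ)) : ZMod 15)
      (admZ_of_isCoprime (isCoprime_row _ 1))
    have h15 := eisE_mul_T_pow k' 15
    have e : k * T ^ (15 * (-(i : ℤ))) = k' * T ^ (15 : ℕ) := by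
      rw [hk', mul_assoc, ← zpow_natCast, ← zpow_add]; congr 2; push_cast; ring
    rw [e, h15, hw] at hz
    refine ⟨z - w, ?_⟩
    push_cast at hz ⊢
    linear_combination hz

/-! ### §3 The Eisenstein period law along the exact descent -/

/-- **THE EISENSTEIN PERIOD LAW** (fuelled form): for every `k = (a b; c d) ∈ SL(2, ℤ)` and `n > |c|`,
`(15/4)·eisE(k) − (descentF n c d).1 − G(c mod 15, d mod 15) ∈ 4ℤ`. Strong induction on `|c|` along the Euclid descent of
part III: the `S`-move and the `T`-moves change both sides by the table values (`eisE_mul_S`, `eisE_mul_T_pow`, the descent's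
own step), the surplus `T^{15j}` of the E-side is `law_period`, and the residue bookkeeping is the decided `law_step`.
[cite: Manin1972, Thm. 1.6] [cite: Stevens1982, §2.5 (PDF p. 38)] -/
theorem eisE_law : ∀ (n : ℕ) (k : SL(2, ℤ)), (k 1 0).natAbs < n →
    ∃ z : ℤ, (15 / 4 : ℚ) * eisE k - ((descentF n (k 1 0) (k 1 1)).1 : ℚ) -
      (lawTab ((k 1 0 : ℤ) : ZMod 15) ((k 1 1 : ℤ) : ZMod 15) : ℚ) = 4 * z
  | 0 => by intro k hk; exact absurd hk (Nat.not_lt_zero _)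
  | n + 1 => by
    intro k hk
    by_cases hc0 : k 1 0 = 0
    · -- base: `c = 0`, `d = ±1`, class `0`, `rep 0 = 1`, `φ = 0` on `c = 0`
      have hdet := Matrix.SpecialLinearGroup.det_coe k
      rw [Matrix.det_fin_two, hc0, mul_zero, sub_zero] at hdet
      have hd : k 1 1 = 1 ∨ k 1 1 = -1 := by
        rcases Int.eq_one_or_neg_one_of_mul_eq_one' hdet with ⟨-, hd⟩ | ⟨-, hd⟩
        · exact Or.inl hd
        · exact Or.inr hd
      have hcls : clsInt (k 1 0) (k 1 1) = 0 := by
        rw [clsInt, hc0]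
        rcases hd with h | h
        · rw [h]; exact tab_base.1
        · rw [h]; exact tab_base.2.1
      have hrep0 : rep 0 = 1 := by
        ext i j
        fin_cases i <;> fin_cases j <;> rfl
      have hE : eisE k = 0 := by
        unfold eisE
        rw [hcls, hrep0, inv_one, mul_one, eisPeriod15SL, hc0, eisPeriod15_c_zero]
      have htab : lawTab ((k 1 0 : ℤ) : ZMod 15) ((k 1 1 : ℤ) : ZMod 15) = 0 := by
        rw [hc0]
        rcases hd with h | h
        · rw [h]; exact lawTab_base.1
        · rw [h]; exact lawTab_base.2
      refine ⟨0, ?_⟩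
      rw [hE, htab, hc0]
      simp [descentF]
    · -- Euclid step
      set c : ℤ := k 1 0 with hcdef
      set d : ℤ := k 1 1 with hddef
      have hrd : d = (d / c) * c + d % c := by
        have := Int.emod_add_mul_ediv d c
        linarith
      have hr_lt : (d % c).natAbs < n := by
        have h1 : 0 ≤ d % c := Int.emod_nonneg d hc0
        have h2 : d % c < |c| := Int.emod_lt_abs d hc0
        have : (d % c).natAbs < c.natAbs := by
          rw [← Int.ofNat_lt]; rw [Int.natAbs_of_nonneg h1, ← Int.abs_eq_natAbs]; exact h2
        omega
      -- `k₁ = k T^{-q}` has bottom row `(c, r)`; `k₂ = k₁ S` has bottom row `(r, -c)`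
      set k₁ : SL(2, ℤ) := k * T ^ (-(d / c)) with hk₁
      have hk₁10 : k₁ 1 0 = c := by
        rw [hk₁]; simp [coe_T_zpow, Matrix.mul_apply, Fin.sum_univ_two, ← hcdef]
      have hk₁11 : k₁ 1 1 = d % c := by
        rw [hk₁]; simp [coe_T_zpow, Matrix.mul_apply, Fin.sum_univ_two, ← hcdef, ← hddef]
        linear_combination hrd
      set k₂ : SL(2, ℤ) := k₁ * S with hk₂
      have hk₂10 : k₂ 1 0 = d % c := by rw [hk₂, mul_S_apply_10, hk₁11]
      have hk₂11 : k₂ 1 1 = -c := by rw [hk₂, mul_S_apply_11, hk₁10]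
      obtain ⟨z₂, hz₂⟩ := eisE_law n k₂ (by rw [hk₂10]; exact hr_lt)
      rw [hk₂10, hk₂11] at hz₂
      -- the `S`-move and the `T`-moves of the E-side
      have hS := eisE_mul_S k₁
      rw [← hk₂, hk₁10, hk₁11] at hS
      set qp : ℕ := ((d / c) % 15).toNat with hqp
      have hT := eisE_mul_T_pow k₁ qp
      rw [hk₁10, hk₁11] at hT
      have hqp15 : (qp : ℤ) = (d / c) % 15 := by
        rw [hqp, Int.toNat_of_nonneg (Int.emod_nonneg _ (by norm_num))]
      -- `k = (k₁ T^{qp}) T^{15·((d/c)/15)}`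
      have hkfac : k = k₁ * T ^ qp * T ^ (15 * ((d / c) / 15)) := by
        rw [hk₁, mul_assoc, mul_assoc, ← zpow_natCast, ← zpow_add, ← zpow_add]
        have e : -(d / c) + ((qp : ℤ) + 15 * ((d / c) / 15)) = 0 := by
          rw [hqp15]; have := Int.emod_add_mul_ediv (d / c) 15; linarith
        rw [e, zpow_zero, mul_one]
      obtain ⟨z₁, hz₁⟩ := eisE_mul_T_zpow_fifteen (k₁ * T ^ qp) ((d / c) / 15)
      rw [← hkfac] at hz₁
      -- one step of the descent
      have hdesc : (descentF (n + 1) c d).1 =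
          (descentF n (d % c) (-c)).1 - sA1 (clsInt c (d % c)) + (tCorr c (d % c) qp).1 := by
        rw [descentF, if_neg hc0]; simp only [Prod.fst_add, Prod.fst_sub, hqp]
      -- the residues: `d ≡ qp·c + r (mod 15)`
      have hcr : IsCoprime c (d % c) := by
        have h0 : IsCoprime c d := isCoprime_row k 1
        have := h0.add_mul_left_right (-(d / c))
        rwa [show d + c * -(d / c) = d % c by rw [Int.emod_def]; ring] at this
      have hqmod : ((((d / c) % 15 : ℤ)) : ZMod 15) = (((d / c : ℤ)) : ZMod 15) := by
        have h := ZMod.intCast_mod (d / c) 15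
        exact_mod_cast h
      have hd15 : ((d : ZMod 15)) = (((qp : ℕ) : ℤ) : ZMod 15) * (c : ZMod 15) + ((d % c : ℤ) : ZMod 15) := by
        rw [hqp15, hqmod]
        conv_lhs => rw [hrd]
        push_cast
        ring
      have hstep := law_step (c : ZMod 15) ((d % c : ℤ) : ZMod 15) ⟨qp, by omega⟩ (admZ_of_isCoprime hcr)
      obtain ⟨z₃, hz₃⟩ := hstep
      have hz₃' := congrArg (Int.cast : ℤ → ℚ) hz₃
      simp only [clsInt] at hS
      refine ⟨z₂ + z₃ + z₁, ?_⟩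
      rw [hdesc, tCorr_fst_eq, clsInt, hd15]
      push_cast at hz₂ hz₃' hS hT hz₁ ⊢
      linear_combination hz₁ + (15 / 4 : ℚ) * hT - (15 / 4 : ℚ) * hS + hz₂ + hz₃'

/-- **The Eisenstein period law for the exact descent vector** (`descent` has enough fuel). [cite: Manin1972, Thm. 1.6] -/
theorem eisE_law_descent (k : SL(2, ℤ)) :
    ∃ z : ℤ, (15 / 4 : ℚ) * eisE k - ((descent (k 1 0) (k 1 1)).1 : ℚ) -
      (lawTab ((k 1 0 : ℤ) : ZMod 15) ((k 1 1 : ℤ) : ZMod 15) : ℚ) = 4 * z :=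
  eisE_law _ k (Nat.lt_succ_self _)

/-! ### §4 Consequences on `Γ₀(15)` and on the coset of `S` (the dyadic cusps) -/

/-- On `Γ₀(15)` the extension is the period itself: `eisE γ = φ(γ)` (class `0`, representative `1`).
[cite: CremonaAlgorithms1997, §2.2] -/
theorem eisE_of_fifteen_dvd_c (k : SL(2, ℤ)) (h : (15 : ℤ) ∣ k 1 0) : eisE k = eisPeriod15SL k := by
  have hc : ((k 1 0 : ℤ) : ZMod 15) = ((0 : ℤ) : ZMod 15) := by
    rw [Int.cast_zero]; exact (ZMod.intCast_zmod_eq_zero_iff_dvd _ 15).mpr (by exact_mod_cast h)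
  have h3 := adm_three k
  have h5 := adm_five k
  rw [hc] at h3 h5
  have hcls : clsInt (k 1 0) (k 1 1) = 0 := by
    rw [clsInt, hc]; exact (tab_gamma0_int (k 1 1) h3 h5).1
  have hrep0 : rep 0 = 1 := by
    ext i j
    fin_cases i <;> fin_cases j <;> rfl
  unfold eisE
  rw [hcls, hrep0, inv_one, mul_one]

/-- **THE LAW ON `Γ₀(15)`**: `(15/4)·φ(γ) − n₁(γ) − ψ(d) ∈ 4ℤ` with `ψ = lawTab 0`, the class of `d` in `(ℤ/15)ˣ/±1 ≅ ℤ/4`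
(`±1, ±2, ±4, ±8 ↦ 0, 1, 2, 3`) — the character of the cyclic cover `X₁(15) → X₀(15)`.
[cite: Stevens1982, §2.5 (PDF p. 38)] [cite: Manin1972, Thm. 1.6] -/
theorem eisPeriod15_law_gamma0 (γ : SL(2, ℤ)) (h : (15 : ℤ) ∣ γ 1 0) :
    ∃ z : ℤ, (15 / 4 : ℚ) * eisPeriod15SL γ - ((descent (γ 1 0) (γ 1 1)).1 : ℚ) -
      (lawTab 0 ((γ 1 1 : ℤ) : ZMod 15) : ℚ) = 4 * z := by
  have hc : ((γ 1 0 : ℤ) : ZMod 15) = 0 := (ZMod.intCast_zmod_eq_zero_iff_dvd _ 15).mpr (by exact_mod_cast h)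
  have hl := eisE_law_descent γ
  rwa [eisE_of_fifteen_dvd_c γ h, hc] at hl

/-- On the coset of `S` (`15 ∣ d`, so `c` is prime to `15`): `eisE k = φ(k S⁻¹)` (class `1`, representative `S`).
[cite: CremonaAlgorithms1997, §2.2] -/
theorem eisE_of_fifteen_dvd_d (k : SL(2, ℤ)) (h : (15 : ℤ) ∣ k 1 1) : eisE k = eisPeriod15SL (k * S⁻¹) := by
  have hd : ((k 1 1 : ℤ) : ZMod 15) = 0 := (ZMod.intCast_zmod_eq_zero_iff_dvd _ 15).mpr (by exact_mod_cast h)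
  have h3 := adm_three k
  have h5 := adm_five k
  rw [hd] at h3 h5
  have hcls : clsInt (k 1 0) (k 1 1) = 1 := by
    rw [clsInt, hd]; exact clsTab_zero_eq_one _ h3 h5
  unfold eisE
  rw [hcls, rep_one_eq_S]

/-- The table on the coset of `S` depends on `c` only (column `d ≡ 0`). [folklore] -/
theorem lawTab_col_zero (k k' : SL(2, ℤ)) (hrow : k' 1 0 = k 1 0) (h : (15 : ℤ) ∣ k 1 1) (h' : (15 : ℤ) ∣ k' 1 1) :
    lawTab ((k' 1 0 : ℤ) : ZMod 15) ((k' 1 1 : ℤ) : ZMod 15) = lawTab ((k 1 0 : ℤ) : ZMod 15) ((k 1 1 : ℤ) : ZMod 15) := by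
  have hd : ((k 1 1 : ℤ) : ZMod 15) = 0 := (ZMod.intCast_zmod_eq_zero_iff_dvd _ 15).mpr (by exact_mod_cast h)
  have hd' : ((k' 1 1 : ℤ) : ZMod 15) = 0 := (ZMod.intCast_zmod_eq_zero_iff_dvd _ 15).mpr (by exact_mod_cast h')
  rw [hd, hd', hrow]

/-- **The law for a PAIR of dyadic-type matrices** (same lower-left entry `c ≠ 0`, `15 ∣ d, 15 ∣ d'` — e.g. the matrices
`(a, −x; 2^m, 15y)` of the cusps `a/2^m`): `(15/4)·(φ(kS⁻¹) − φ(k'S⁻¹)) − (n₁(k) − n₁(k')) ∈ 4ℤ`; the congruence character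
cancels. Input of the level-15 (★-SymbC) theorem. [cite: Stevens1982, §2.5 (PDF p. 38)] [cite: Manin1972, Thm. 1.6] -/
theorem law_pair {k k' : SL(2, ℤ)} (hrow : k' 1 0 = k 1 0) (h : (15 : ℤ) ∣ k 1 1) (h' : (15 : ℤ) ∣ k' 1 1) :
    ∃ z : ℤ, (15 / 4 : ℚ) * (eisPeriod15SL (k * S⁻¹) - eisPeriod15SL (k' * S⁻¹)) -
      (((descent (k 1 0) (k 1 1)).1 - (descent (k' 1 0) (k' 1 1)).1 : ℤ) : ℚ) = 4 * z := by
  obtain ⟨z, hz⟩ := eisE_law_descent k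
  obtain ⟨z', hz'⟩ := eisE_law_descent k'
  rw [eisE_of_fifteen_dvd_d k h] at hz
  rw [eisE_of_fifteen_dvd_d k' h', lawTab_col_zero k k' hrow h h'] at hz'
  refine ⟨z - z', ?_⟩
  push_cast
  linear_combination hz - hz'

end Summit.BirchSwinnertonDyer.Rank2.LevelFifteen
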